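import Mathlib
import HarnessLib

/-!
# Chart weights along the fibre of a proper map (partition of unity for a resolution of singularities)

Topological preliminaries for the change of variables along a resolution of singularities
(`ResolutionChartSum.lean`): given a continuous map `g : M → ℝ^d` from a Hausdorff space which is
proper over an open `W ∋ 0`, and at every point `p` of the fibre `g⁻¹(0)` a chart
`φ_p : M ⊇ source → ℝ^d` centred at `p` whose target contains the closed cube `‖u‖ ≤ δ_p`, we produce
finitely many fibre points `q ∈ s`, a radius `r > 0` and continuous weights `ω_q ≥ 0` on `M`,
supported in the open chart cubes `{‖φ_q ·‖ < δ_q}`, positive at the centres, and summing to `1` on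
`g⁻¹(closed cube of radius r)` — the "sufficiently fine partition of unity" of
Arnold–Gusein-Zade–Varchenko II, Part II §7.3 (proof of Thm. 7.5) and of Lin 2017, proof of
Lemma 2.4 (fibre compactness, the neighbourhood claim `ρ(⋃ M_y) ⊇ W_x`, partition functions
positive at the chart centres). Everything here is PROVED; no definitions, no named facts.

## References

* S. Lin, *Algebraic methods for evaluating integrals in Bayesian statistics*, arXiv:1003.5338,
  proof of Lemma 2.4. [Lin2017]
* V. I. Arnold, S. M. Gusein-Zade, A. N. Varchenko, *Singularities of Differentiable Maps II*
  (2012), Part II §7.3, proof of Theorem 7.5. [ArnoldGuseinzadeVarchenko2012]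
-/

noncomputable section

open Set Filter Metric Function
open _root_.Topology

namespace Literature.Analysis.Calculus

namespace Resolution

variable {d : ℕ}

/-! ## Cubes are balls of the sup norm; clamping into a closed cube

The cube forms `‖u‖ ≤ δ ↔ ∀ j, |u j| ≤ δ` (`0 ≤ δ`) and `‖u‖ < δ ↔ ∀ j, |u j| < δ` (`0 < δ`) are
Mathlib's `pi_norm_le_iff_of_nonneg` and `pi_norm_lt_iff` (with `Real.norm_eq_abs`, a `rfl`);
they are not restated here. -/

/-- **Clamping into the closed cube `‖u‖ ≤ δ`**: a continuous retraction `c` of `ℝ^d` onto the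
closed cube, fixing the cube pointwise and the origin. [folklore] -/
theorem exists_clamp {δ : ℝ} (hδ : 0 < δ) :
    ∃ c : (Fin d → ℝ) → (Fin d → ℝ), Continuous c ∧ (∀ u, ‖c u‖ ≤ δ) ∧
      (∀ u, ‖u‖ ≤ δ → c u = u) ∧ c 0 = 0 := by
  refine ⟨fun u j => max (-δ) (min δ (u j)), ?_, fun u => ?_, fun u hu => ?_, ?_⟩
  · exact continuous_pi fun j =>
      continuous_const.max (continuous_const.min (continuous_apply j))
  · rw [pi_norm_le_iff_of_nonneg hδ.le]
    intro j
    rw [Real.norm_eq_abs, abs_le]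
    exact ⟨le_max_left _ _, max_le (by linarith) (min_le_left _ _)⟩
  · funext j
    have hj := (pi_norm_le_iff_of_nonneg hδ.le).1 hu j
    rw [Real.norm_eq_abs, abs_le] at hj
    show max (-δ) (min δ (u j)) = u j
    rw [min_eq_right hj.2, max_eq_right hj.1]
  · funext j
    simp [hδ.le]

/-! ## Chart bumps on a Hausdorff space -/

variable {M : Type*} [TopologicalSpace M]

/-- **Chart bump.** For a chart `φ` of a Hausdorff space whose target contains the closed cube of
radius `δ > 0`, the function `m ↦ max 0 (δ - ‖φ m‖)` on `φ.source`, extended by `0`, is continuous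
on `M`, non-negative, and non-zero exactly on the open chart cube `{m ∈ source | ‖φ m‖ < δ}`.
[folklore] -/
theorem continuous_chartBump [T2Space M] (φ : OpenPartialHomeomorph M (Fin d → ℝ)) {δ : ℝ}
    (hball : closedBall (0 : Fin d → ℝ) δ ⊆ φ.target) :
    Continuous (φ.source.indicator fun m => max 0 (δ - ‖φ m‖)) := by
  set D : Set M := φ.symm '' closedBall (0 : Fin d → ℝ) δ with hD
  have hDc : IsClosed D :=
    ((isCompact_closedBall (0 : Fin d → ℝ) δ).image_of_continuousOn
      (φ.continuousOn_symm.mono hball)).isClosed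
  have hDsrc : D ⊆ φ.source := by
    rintro _ ⟨u, hu, rfl⟩
    exact φ.map_target (hball hu)
  rw [continuous_iff_continuousAt]
  intro m
  by_cases hm : m ∈ φ.source
  · -- on the open source the bump is `max 0 (δ - ‖φ ·‖)`
    have heq : (φ.source.indicator fun m => max 0 (δ - ‖φ m‖)) =ᶠ[𝓝 m]
        fun m => max 0 (δ - ‖φ m‖) := by
      filter_upwards [φ.open_source.mem_nhds hm] with m' hm'
      rw [indicator_of_mem hm']
    refine (ContinuousAt.congr ?_ heq.symm)
    exact (continuous_const.max (continuous_const.sub continuous_norm)).continuousAt.comp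
      (φ.continuousAt hm)
  · -- off the source the bump vanishes near `m` (the compact `D` is closed and misses `m`)
    have hmD : m ∉ D := fun h => hm (hDsrc h)
    have heq : (φ.source.indicator fun m => max 0 (δ - ‖φ m‖)) =ᶠ[𝓝 m] fun _ => 0 := by
      filter_upwards [hDc.isOpen_compl.mem_nhds hmD] with m' hm'
      by_cases hm's : m' ∈ φ.source
      · rw [indicator_of_mem hm's]
        refine max_eq_left ?_
        rw [sub_nonpos]
        by_contra hlt
        push Not at hlt
        exact hm' ⟨φ m', mem_closedBall_zero_iff.2 hlt.le, φ.left_inv hm's⟩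
      · rw [indicator_of_notMem hm's]
    exact (continuousAt_const.congr heq.symm)

/-- Values of the chart bump: non-negative. [folklore] -/
theorem chartBump_nonneg (φ : OpenPartialHomeomorph M (Fin d → ℝ)) (δ : ℝ) (m : M) :
    0 ≤ φ.source.indicator (fun m => max 0 (δ - ‖φ m‖)) m := by
  by_cases hm : m ∈ φ.source
  · rw [indicator_of_mem hm]; exact le_max_left _ _
  · rw [indicator_of_notMem hm]

/-- Values of the chart bump: non-zero only on the open chart cube. [folklore] -/
theorem chartBump_ne_zero (φ : OpenPartialHomeomorph M (Fin d → ℝ)) (δ : ℝ) {m : M}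
    (h : φ.source.indicator (fun m => max 0 (δ - ‖φ m‖)) m ≠ 0) :
    m ∈ φ.source ∧ ‖φ m‖ < δ := by
  by_cases hm : m ∈ φ.source
  · rw [indicator_of_mem hm] at h
    refine ⟨hm, ?_⟩
    by_contra hle
    push Not at hle
    exact h (max_eq_left (by linarith))
  · rw [indicator_of_notMem hm] at h
    exact (h rfl).elim

/-- Values of the chart bump: positive at the centre (`φ p = 0`). [folklore] -/
theorem chartBump_pos (φ : OpenPartialHomeomorph M (Fin d → ℝ)) {δ : ℝ} (hδ : 0 < δ) {p : M}
    (hp : p ∈ φ.source) (h0 : φ p = 0) :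
    0 < φ.source.indicator (fun m => max 0 (δ - ‖φ m‖)) p := by
  rw [indicator_of_mem hp, h0, norm_zero, sub_zero]
  exact lt_max_of_lt_right hδ

/-! ## Finitely many chart cubes cover the fibre; normalised weights -/

/-- **Chart weights along the fibre of a proper map** (the "sufficiently fine partition of unity"
of AGV II §7.3 / the partition `{σ_y}` positive at the chart centres of Lin 2017, proof of
Lemma 2.4, with Lin's neighbourhood claim `ρ(⋃ M_y) ⊇ W_x`). Let `g : M → ℝ^d` be continuous on a
Hausdorff space, proper over an open `W ∋ 0` (`g⁻¹ K` compact for compact `K ⊆ W`), and for each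
point `p` of the fibre `g⁻¹ 0` let `φ_p` be a chart with `p ∈ source`, `φ_p p = 0` and target
containing the closed cube of radius `δ_p > 0`. Then there are finitely many fibre points `q ∈ s`,
a radius `r > 0` with the closed cube of radius `r` inside `W`, and continuous weights `ω_q ≥ 0`
on `M` with `ω_q q > 0`, `ω_q` vanishing outside the open chart cube `{m ∈ source_q | ‖φ_q m‖ < δ_q}`,
and `∑_q ω_q = 1` on `g⁻¹ {‖·‖ ≤ r}`.
[cite: Lin2017, proof of Lemma 2.4] [cite: ArnoldGuseinzadeVarchenko2012, Part II §7.3] -/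
theorem exists_weights [T2Space M] (g : M → (Fin d → ℝ)) (hg : Continuous g)
    {W : Set (Fin d → ℝ)} (hW : IsOpen W) (h0 : (0 : Fin d → ℝ) ∈ W)
    (hprop : ∀ K ⊆ W, IsCompact K → IsCompact (g ⁻¹' K))
    (φ : M → OpenPartialHomeomorph M (Fin d → ℝ)) (δ : M → ℝ)
    (hδ : ∀ p, g p = 0 → 0 < δ p) (hsrc : ∀ p, g p = 0 → p ∈ (φ p).source)
    (hctr : ∀ p, g p = 0 → φ p p = 0)
    (htgt : ∀ p, g p = 0 → closedBall (0 : Fin d → ℝ) (δ p) ⊆ (φ p).target) :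
    ∃ (s : Finset M) (r : ℝ) (ω : M → M → ℝ),
      (∀ q ∈ s, g q = 0) ∧ 0 < r ∧ closedBall (0 : Fin d → ℝ) r ⊆ W ∧
      (∀ q ∈ s, Continuous (ω q)) ∧ (∀ q ∈ s, ∀ m, 0 ≤ ω q m) ∧ (∀ q ∈ s, 0 < ω q q) ∧
      (∀ q ∈ s, ∀ m, ω q m ≠ 0 → m ∈ (φ q).source ∧ ‖φ q m‖ < δ q) ∧
      (∀ m, ‖g m‖ ≤ r → ∑ q ∈ s, ω q m = 1) := by
  classical
  -- the open chart cubes centred on the fibre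
  set C : M → Set M := fun q => (φ q).source ∩ (φ q) ⁻¹' ball 0 (δ q) with hC
  have hCo : ∀ q, IsOpen (C q) := fun q => (φ q).isOpen_inter_preimage isOpen_ball
  have hqC : ∀ q, g q = 0 → q ∈ C q := fun q hq =>
    ⟨hsrc q hq, by
      show φ q q ∈ ball (0 : Fin d → ℝ) (δ q)
      rw [hctr q hq]
      exact mem_ball_self (hδ q hq)⟩
  -- the fibre is compact and covered by finitely many cubes centred on it
  have hΦ : IsCompact (g ⁻¹' {0}) := hprop {0} (singleton_subset_iff.2 h0) isCompact_singleton
  obtain ⟨s, hsΦ, hcover⟩ : ∃ s : Finset M, (∀ q ∈ s, g q = 0) ∧ g ⁻¹' {0} ⊆ ⋃ q ∈ s, C q := by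
    obtain ⟨t, ht⟩ := hΦ.elim_finite_subcover (fun q : g ⁻¹' ({0} : Set (Fin d → ℝ)) => C q)
      (fun q => hCo q) (fun p hp => mem_iUnion.2 ⟨⟨p, hp⟩, hqC p hp⟩)
    refine ⟨Finset.image Subtype.val t, fun q hq => ?_, fun p hp => ?_⟩
    · obtain ⟨q', -, rfl⟩ := Finset.mem_image.1 hq
      exact q'.2
    · obtain ⟨i, hi, hpi⟩ := mem_iUnion₂.1 (ht hp)
      exact mem_iUnion₂.2 ⟨i.1, Finset.mem_image.2 ⟨i, hi, rfl⟩, hpi⟩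
  have hUo : IsOpen (⋃ q ∈ s, C q) := isOpen_biUnion fun q _ => hCo q
  -- Lin's neighbourhood claim: a cube around `0` whose preimage lies in the union of the cubes
  obtain ⟨ρ₁, hρ₁, hρ₁W⟩ : ∃ ρ₁ > 0, closedBall (0 : Fin d → ℝ) ρ₁ ⊆ W := by
    obtain ⟨ε, hε, hεW⟩ := Metric.isOpen_iff.1 hW 0 h0
    exact ⟨ε / 2, half_pos hε, (closedBall_subset_ball (half_lt_self hε)).trans hεW⟩
  have hKc : IsCompact (g ⁻¹' closedBall 0 ρ₁) := hprop _ hρ₁W (isCompact_closedBall _ _)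
  have hFc : IsCompact (g ⁻¹' closedBall 0 ρ₁ \ ⋃ q ∈ s, C q) := hKc.diff hUo
  have hGc : IsClosed (g '' (g ⁻¹' closedBall 0 ρ₁ \ ⋃ q ∈ s, C q)) := (hFc.image hg).isClosed
  have h0G : (0 : Fin d → ℝ) ∉ g '' (g ⁻¹' closedBall 0 ρ₁ \ ⋃ q ∈ s, C q) := by
    rintro ⟨q, ⟨-, hqU⟩, hq0⟩
    exact hqU (hcover hq0)
  obtain ⟨ρ₂, hρ₂, hρ₂G⟩ := Metric.mem_nhds_iff.1 (hGc.isOpen_compl.mem_nhds h0G)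
  set r : ℝ := min ρ₁ (ρ₂ / 2) with hr
  have hrpos : 0 < r := lt_min hρ₁ (half_pos hρ₂)
  have hrW : closedBall (0 : Fin d → ℝ) r ⊆ W :=
    (closedBall_subset_closedBall (min_le_left _ _)).trans hρ₁W
  have hrU : ∀ m, ‖g m‖ ≤ r → m ∈ ⋃ q ∈ s, C q := by
    intro m hm
    have hmK : m ∈ g ⁻¹' closedBall 0 ρ₁ :=
      mem_closedBall_zero_iff.2 (hm.trans (min_le_left _ _))
    by_contra hmU
    have hgm : g m ∈ ball (0 : Fin d → ℝ) ρ₂ := by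
      rw [mem_ball_zero_iff]
      exact lt_of_le_of_lt (hm.trans (min_le_right _ _)) (half_lt_self hρ₂)
    exact hρ₂G hgm ⟨m, ⟨hmK, hmU⟩, rfl⟩
  -- chart bumps and their sum
  set B : M → M → ℝ := fun q => (φ q).source.indicator fun m => max 0 (δ q - ‖φ q m‖) with hB
  have hBc : ∀ q ∈ s, Continuous (B q) := fun q hq =>
    continuous_chartBump (φ q) (htgt q (hsΦ q hq))
  have hB0 : ∀ q m, 0 ≤ B q m := fun q m => chartBump_nonneg (φ q) (δ q) m
  have hBC : ∀ q m, B q m ≠ 0 → m ∈ (φ q).source ∧ ‖φ q m‖ < δ q := fun q m h =>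
    chartBump_ne_zero (φ q) (δ q) h
  have hBpos : ∀ q m, m ∈ C q → 0 < B q m := by
    rintro q m ⟨hms, hmb⟩
    simp only [hB, indicator_of_mem hms]
    have : ‖φ q m‖ < δ q := mem_ball_zero_iff.1 hmb
    exact lt_max_of_lt_right (by linarith)
  set S : M → ℝ := fun m => ∑ q ∈ s, B q m with hS
  have hSc : Continuous S := continuous_finsetSum _ fun q hq => hBc q hq
  have hSpos : ∀ m, m ∈ (⋃ q ∈ s, C q) → 0 < S m := by
    intro m hm
    obtain ⟨q, hq, hmq⟩ := mem_iUnion₂.1 hm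
    exact lt_of_lt_of_le (hBpos q m hmq)
      (Finset.single_le_sum (f := fun q => B q m) (fun q _ => hB0 q m) hq)
  -- a positive lower bound for the sum on the compact `g⁻¹ {‖·‖ ≤ r}`
  have hK' : IsCompact (g ⁻¹' closedBall 0 r) := hprop _ hrW (isCompact_closedBall _ _)
  obtain ⟨c, hc, hcS⟩ : ∃ c : ℝ, 0 < c ∧ ∀ m, ‖g m‖ ≤ r → c ≤ S m := by
    by_cases hne : (g ⁻¹' closedBall (0 : Fin d → ℝ) r).Nonempty
    · obtain ⟨m₀, hm₀, hmin⟩ := hK'.exists_isMinOn hne hSc.continuousOn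
      refine ⟨S m₀, hSpos m₀ (hrU m₀ (mem_closedBall_zero_iff.1 hm₀)), fun m hm => ?_⟩
      exact hmin (mem_closedBall_zero_iff.2 hm)
    · refine ⟨1, one_pos, fun m hm => ?_⟩
      exact (hne ⟨m, mem_closedBall_zero_iff.2 hm⟩).elim
  -- the normalised weights
  have hden : ∀ m, 0 < max c (S m) := fun m => lt_max_of_lt_left hc
  refine ⟨s, r, fun q m => B q m / max c (S m), hsΦ, hrpos, hrW, fun q hq => ?_,
    fun q hq m => div_nonneg (hB0 q m) (hden m).le, fun q hq => ?_, fun q hq m h => ?_,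
    fun m hm => ?_⟩
  · exact (hBc q hq).div (continuous_const.max hSc) fun m => (hden m).ne'
  · exact div_pos (hBpos q q (hqC q (hsΦ q hq))) (hden q)
  · refine hBC q m fun h0 => h ?_
    show B q m / max c (S m) = 0
    rw [h0, zero_div]
  · have hSm : max c (S m) = S m := max_eq_right (hcS m hm)
    show ∑ q ∈ s, B q m / max c (S m) = 1
    rw [hSm, ← Finset.sum_div]
    exact div_self (lt_of_lt_of_le hc (hcS m hm)).ne'

end Resolution

end Literature.Analysis.Calculus

end
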